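import Literature.Computability.Complexity.CatalyticMachines
import Literature.Computability.Complexity.SpaceLoop
import Mathlib.Tactic.DeriveFintype
import HarnessLib

/-!
# `L ⊆ CL`: a space machine with two idle catalytic stacks

Sibling proof file of `CatalyticSpace.lean` / `CatalyticMachines.lean` (the class `CL`; catalytic
machines `CatalyticMachine`, the decision predicate `CatalyticDecides`, the classes `CSPACE s c`,
after Buhrman–Cleve–Koucký–Loff–Speelman 2014 and Koucký–Mertz–Pyne–Sami 2025). It supplies the first elementary fact about the
model that every account states:

* **`DSPACE` inside `CSPACE`, `LOGSPACE ⊆ CL`** (BCKLS, §1: "CSPACE(log n) is [at least as]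
  powerful [as] ordinary logspace (DSPACE(log n) or L)"; the trivial direction of their chain
  `L ⊆ NL ⊆ TC¹ ⊆ CL ⊆ ZPP`; KMPS §1: `L ⊆ CL`). The machine: `CatalyticIdle.idle M` is the space
  machine `M` with two further Boolean stacks `CA`, `CB` on which no statement ever acts
  (`CatalyticIdle.trStmt` re-indexes the statements of `M` along `Sum.inl`); started with any
  content `τ` on `CA`, its run is the run of `M` with `τ` riding along untouched
  (`CatalyticIdle.step_cfgM`, `reaches_cfgM`, `cfgM_mem_eval`), so it keeps the input, uses the
  work space of `M` as clean space (`cleanSpace_cfgM`), never changes the catalytic stacks, and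
  halts with `M`'s answer and `CA = τ`, `CB = []` (`CatalyticIdle.catalyticDecides`). Hence
  `spaceClass_subset_CSPACE : SpaceClass s ⊆ CSPACE s c` for every catalytic length `c`,
  `DSPACE_subset_CSPACE`, and `LOGSPACE_subset_CL`.
* Non-vacuity (`∅ ∈ CL`, `univ ∈ CL`, through `∅, univ ∈ SpaceClass 1 ⊆ LOGSPACE`) is the sibling
  file `TrivialLanguagesSpace.lean`.

The simulation pattern (stacks `M.K ⊕ Aux`, statements translated along `inl`, configurations
embedded by `cfgM`) is the one of `TimeToSpace.lean`/`SpaceLoop.lean`, in its simplest instance: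
no control labels, no state register, label and state types unchanged.

## References

* H. Buhrman, R. Cleve, M. Koucký, B. Loff, F. Speelman, *Computing with a full memory: catalytic
  space*, STOC 2014 [BuhrmanEtAl2014] (ECCC TR14-053: §1 p. 2, §4 Def. 14, Thm. 19).
* M. Koucký, I. Mertz, E. Pyne, S. Sami, *Collapsing catalytic classes*, 2025 [KouckyEtAl2025]
  (§1: `L ⊆ CL ⊆ ZPP`; Def. 3, Def. 4).
* S. Arora, B. Barak, *Computational Complexity: A Modern Approach*, CUP 2009, Def. 4.1, 4.5
  [AroraBarak2009].
-/

noncomputable section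

namespace Literature.Computability.Complexity

open _root_.Computability Turing StateTransition Function

variable {Γ₀ Γ₁ : Type}

/-! ### The idle-stacks construction -/

namespace CatalyticIdle

/-- The two added stacks: `CA` (right half of the catalytic tape, initially the whole content) and
`CB` (left half, initially empty). [folklore] -/
inductive Aux
  | CA
  | CB
  deriving DecidableEq, Fintype

section Machine

variable {K : Type} {G : K → Type} {Λ σ : Type}

/-- Stack alphabets of the extended machine: those of `M` on `inl`, `Bool` on the two added stacks.
Written with `casesOn` so that it unfolds by `rfl` on constructors. [folklore] -/
abbrev IΓ (G : K → Type) : K ⊕ Aux → Type := fun j =>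
  Sum.casesOn (motive := fun _ => Type) j G (fun _ => Bool)

/-- Stack contents of the extended machine from the stacks `S` of `M` and the contents `a`, `b` of
`CA`, `CB`. [folklore] -/
def mkStk (S : ∀ k, List (G k)) (a b : List Bool) : ∀ j : K ⊕ Aux, List (IΓ G j)
  | Sum.inl k => S k
  | Sum.inr Aux.CA => a
  | Sum.inr Aux.CB => b

section StkLemmas

variable (S : ∀ k, List (G k)) (a b : List Bool)

/-- Reading a stack of `M`. [folklore] -/
@[simp] theorem mkStk_inl (k : K) : mkStk S a b (Sum.inl k) = S k := rfl
/-- Reading `CA`. [folklore] -/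
@[simp] theorem mkStk_CA : mkStk S a b (Sum.inr Aux.CA) = a := rfl
/-- Reading `CB`. [folklore] -/
@[simp] theorem mkStk_CB : mkStk S a b (Sum.inr Aux.CB) = b := rfl

variable {dKA : DecidableEq (K ⊕ Aux)}

/-- Writing a stack of `M` (any decidability instance on `K ⊕ Aux`, so that the lemma also fires
on the instance bundled in a `FinTM2`). [folklore] -/
@[simp] theorem mkStk_update_inl [DecidableEq K] (k : K) (L : List (G k)) :
    @update _ _ dKA (mkStk S a b) (Sum.inl k) L = mkStk (update S k L) a b := by
  funext j
  rcases j with k' | c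
  · rcases eq_or_ne k' k with rfl | h
    · simp
    · rw [update_of_ne (by simpa using h)]; simp [update_of_ne h]
  · rw [update_of_ne (by simp)]; cases c <;> rfl

/-- Writing `CA`. [folklore] -/
@[simp] theorem mkStk_update_CA (a' : List Bool) :
    @update _ _ dKA (mkStk S a b) (Sum.inr Aux.CA) a' = mkStk S a' b := by
  funext j
  rcases j with k' | c
  · rw [update_of_ne (by simp)]; rfl
  · cases c
    · simp
    · rw [update_of_ne (by simp)]; rfl

/-- The empty stack assignment. [folklore] -/
theorem mkStk_bot :
    mkStk (fun k => ([] : List (G k))) [] [] = fun j => ([] : List (IΓ G j)) := by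
  funext j
  rcases j with k | c
  · rfl
  · cases c <;> rfl

end StkLemmas

/-- Translation of the statements of `M`: the same statement acting on the `inl` stacks; nothing
ever touches `CA`, `CB`. [folklore] -/
def trStmt : TM2.Stmt G Λ σ → TM2.Stmt (IΓ G) Λ σ
  | TM2.Stmt.push k f q => TM2.Stmt.push (Sum.inl k) f (trStmt q)
  | TM2.Stmt.peek k f q => TM2.Stmt.peek (Sum.inl k) f (trStmt q)
  | TM2.Stmt.pop k f q => TM2.Stmt.pop (Sum.inl k) f (trStmt q)
  | TM2.Stmt.load f q => TM2.Stmt.load f (trStmt q)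
  | TM2.Stmt.branch p q₁ q₂ => TM2.Stmt.branch p (trStmt q₁) (trStmt q₂)
  | TM2.Stmt.goto l => TM2.Stmt.goto l
  | TM2.Stmt.halt => TM2.Stmt.halt

/-- The embedded configuration: label, state and stacks of `M`, contents `a`, `b` on `CA`, `CB`.
[folklore] -/
def cfgM (c : TM2.Cfg G Λ σ) (a b : List Bool) : TM2.Cfg (IΓ G) Λ σ :=
  ⟨c.l, c.var, mkStk c.stk a b⟩

/-- Reading a stack of `M` off an embedded configuration. [folklore] -/
@[simp] theorem cfgM_stk_inl (c : TM2.Cfg G Λ σ) (a b : List Bool) (k : K) :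
    (cfgM c a b).stk (Sum.inl k) = c.stk k := rfl

/-- Reading `CA` off an embedded configuration. [folklore] -/
@[simp] theorem cfgM_stk_CA (c : TM2.Cfg G Λ σ) (a b : List Bool) :
    (cfgM c a b).stk (Sum.inr Aux.CA) = a := rfl

/-- Reading `CB` off an embedded configuration. [folklore] -/
@[simp] theorem cfgM_stk_CB (c : TM2.Cfg G Λ σ) (a b : List Bool) :
    (cfgM c a b).stk (Sum.inr Aux.CB) = b := rfl

/-- One statement of `M` is simulated exactly by its translation, the added stacks riding along.
[folklore] -/
theorem stepAux_trStmt [DecidableEq K] (q : TM2.Stmt G Λ σ) (v : σ) (S : ∀ k, List (G k))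
    (a b : List Bool) :
    TM2.stepAux (trStmt q) v (mkStk S a b) = cfgM (TM2.stepAux q v S) a b := by
  induction q generalizing v S with
  | push k f q ih =>
    simp only [trStmt, TM2.stepAux]
    rw [← ih, mkStk_inl, mkStk_update_inl]
  | peek k f q ih => simp only [trStmt, TM2.stepAux]; exact ih _ _
  | pop k f q ih =>
    simp only [trStmt, TM2.stepAux]
    rw [← ih, mkStk_inl, mkStk_update_inl]
  | load f q ih => simp only [trStmt, TM2.stepAux]; exact ih _ _
  | branch p q₁ q₂ ih₁ ih₂ =>
    simp only [trStmt, TM2.stepAux]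
    cases p v
    · exact ih₂ _ _
    · exact ih₁ _ _
  | goto l => rfl
  | halt => rfl

end Machine

section Bundled

variable (M : FinTM2)

/-- The (unbundled) type of configurations of the extended machine. [folklore] -/
abbrev ICfg : Type := TM2.Cfg (IΓ M.Γ) M.Λ M.σ

/-- **The extended machine** of a bundled TM2 machine `M`: stacks `M.K ⊕ Aux` (input and output
stacks those of `M` on `inl`), the labels, states, main label and initial state of `M`, and the
translated statements. Reducible, so that the projections `(idleTM M).Λ`, `(idleTM M).k₀`, …
unfold during unification (the embedded configurations `cfgM c a b`, `c : M.Cfg`, are then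
recognised by `rw`/`simp` whichever way their implicit arguments were elaborated). [folklore] -/
abbrev idleTM : FinTM2 :=
  letI := M.kFin; letI := M.ΛFin; letI := M.σFin
  { K := M.K ⊕ Aux
    k₀ := Sum.inl M.k₀
    k₁ := Sum.inl M.k₁
    Γ := IΓ M.Γ
    Λ := M.Λ
    main := M.main
    σ := M.σ
    initialState := M.initialState
    Γk₀Fin := M.Γk₀Fin
    m := fun l => trStmt (M.m l) }

/-- **A step of `M` is a step of the extended machine on embedded configurations**, and the
extended machine halts exactly where `M` does. [folklore] -/
theorem step_cfgM (c : M.Cfg) (a b : List Bool) :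
    (idleTM M).step (cfgM c a b) = (M.step c).map fun d => cfgM d a b := by
  obtain ⟨_ | l, v, S⟩ := c
  · rfl
  · change some (TM2.stepAux (trStmt (M.m l)) v (mkStk S a b)) =
      some (cfgM (TM2.stepAux (M.m l) v S) a b)
    rw [stepAux_trStmt]

/-- A run of `M` is a run of the extended machine on embedded configurations. [folklore] -/
theorem cfgM_reaches {c d : M.Cfg} (h : Reaches M.step c d) (a b : List Bool) :
    Reaches (idleTM M).step (cfgM c a b) (cfgM d a b) := by
  induction h with
  | refl => exact Relation.ReflTransGen.refl
  | @tail d₁ d₂ _ hde ih =>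
    refine Relation.ReflTransGen.tail ih ?_
    have h2 : M.step d₁ = some d₂ := Option.mem_def.1 hde
    show (idleTM M).step (cfgM d₁ a b) = some (cfgM d₂ a b)
    rw [step_cfgM M d₁ a b, h2]
    rfl

/-- **Every configuration reachable from an embedded configuration is embedded**, over a
configuration of `M` reachable from the base, with the same contents of the added stacks.
[folklore] -/
theorem reaches_cfgM {c : M.Cfg} {a b : List Bool} {e : ICfg M}
    (h : Reaches (idleTM M).step (cfgM c a b) e) :
    ∃ d, Reaches M.step c d ∧ e = cfgM d a b := by
  induction h with
  | refl => exact ⟨c, Relation.ReflTransGen.refl, rfl⟩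
  | @tail e₁ e₂ _ hef ih =>
    obtain ⟨d, hcd, rfl⟩ := ih
    have hef' : (idleTM M).step (cfgM d a b) = some e₂ := Option.mem_def.1 hef
    rw [step_cfgM M d a b] at hef'
    cases hd : M.step d with
    | none => rw [hd] at hef'; cases hef'
    | some d' =>
      rw [hd] at hef'
      obtain rfl := Option.some.inj hef'
      exact ⟨d', hcd.tail (Option.mem_def.2 hd), rfl⟩

/-- The embedded halting configuration of `M` is a halting configuration of the extended machine,
i.e. `eval` is transported along `cfgM`. [folklore] -/
theorem cfgM_mem_eval {c d : M.Cfg} (h : d ∈ eval M.step c) (a b : List Bool) :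
    cfgM d a b ∈ eval (idleTM M).step (cfgM c a b) := by
  obtain ⟨hr, hd⟩ := mem_eval.1 h
  refine mem_eval.2 ⟨cfgM_reaches M hr a b, ?_⟩
  rw [step_cfgM M d a b, hd]
  rfl

/-- The initial configuration of the extended machine is the embedded initial configuration of
`M` (nothing on the added stacks). [folklore] -/
theorem initList_idleTM (l : List (M.Γ M.k₀)) :
    initList (idleTM M) l = cfgM (initList M l) [] [] := by
  rw [TM2Comp.initList_eq, TM2Comp.initList_eq]
  change (⟨some M.main, M.initialState, update (fun j => ([] : List (IΓ M.Γ j))) (Sum.inl M.k₀) l⟩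
      : ICfg M) = _
  rw [← mkStk_bot, mkStk_update_inl]
  rfl

/-- The stacks of `M`, seen inside the extended machine, are the image of `Sum.inl`; erasing the
two added stacks and two stacks of `M` leaves the image of the corresponding erasure. [folklore] -/
theorem cleanStacks_eq (k₀ kL : M.K) :
    letI := M.kFin
    ((((Finset.univ : Finset (M.K ⊕ Aux)).erase (Sum.inl k₀)).erase (Sum.inl kL)).erase
        (Sum.inr Aux.CA)).erase (Sum.inr Aux.CB) =
      ((Finset.univ.erase k₀).erase kL).image Sum.inl := by
  ext j
  rcases j with k | c
  · simp [and_assoc]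
  · cases c <;> simp

end Bundled

/-- **The idle catalytic machine of a space machine**: the extended machine `idleTM M.tm` with the
input conventions of `M` (input stacks `inl k₀`/`inl kL`, output stack `inl k₁`, the alphabet
identifications of `M`) and the added Boolean stacks `CA`, `CB` as catalytic stacks.
[cite: BuhrmanEtAl2014, §1 (CSPACE(log n) versus DSPACE(log n)) and Def. 14] -/
def idle (M : SpaceMachine Γ₀ Γ₁) : CatalyticMachine Γ₀ Γ₁ where
  tm := idleTM M.tm
  inputAlphabet := M.inputAlphabet
  outputAlphabet := M.outputAlphabet
  kL := Sum.inl M.kL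
  kL_ne_k₀ := fun h => M.kL_ne_k₀ (Sum.inl.inj h)
  kL_ne_k₁ := fun h => M.kL_ne_k₁ (Sum.inl.inj h)
  leftAlphabet := M.leftAlphabet
  kA := Sum.inr Aux.CA
  kB := Sum.inr Aux.CB
  kA_ne_k₀ := Sum.inr_ne_inl
  kA_ne_k₁ := Sum.inr_ne_inl
  kA_ne_kL := Sum.inr_ne_inl
  kB_ne_k₀ := Sum.inr_ne_inl
  kB_ne_k₁ := Sum.inr_ne_inl
  kB_ne_kL := Sum.inr_ne_inl
  kA_ne_kB := fun h => Aux.noConfusion (Sum.inr.inj h)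
  catAlphabet := Equiv.refl Bool
  retAlphabet := Equiv.refl Bool

section Idle

variable (M : SpaceMachine Γ₀ Γ₁)

/-- The start configuration of the idle catalytic machine on `x`, `τ` is the embedded initial
configuration of `M` on `x` with `τ` on `CA`. [folklore] -/
theorem catInit_idle (x : List Γ₀) (τ : List Bool) :
    (idle M).catInit x τ = cfgM (M.init x) (τ.map (idle M).catAlphabet.symm) [] := by
  have h0 : (idle M).init x = cfgM (M.init x) [] [] := initList_idleTM M.tm _
  change (⟨((idle M).init x).l, ((idle M).init x).var,
      update ((idle M).init x).stk (Sum.inr Aux.CA) (τ.map (idle M).catAlphabet.symm)⟩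
        : ICfg M.tm) = _
  rw [h0]
  change (⟨(M.init x).l, (M.init x).var, update (mkStk (M.init x).stk [] []) (Sum.inr Aux.CA)
      (τ.map (idle M).catAlphabet.symm)⟩ : ICfg M.tm) = _
  rw [mkStk_update_CA]
  rfl

/-- An embedded configuration spells the input that its base configuration spells. [folklore] -/
theorem inputOf_cfgM (c : M.tm.Cfg) (a b : List Bool) :
    (idle M).inputOf (cfgM c a b) = M.inputOf c := rfl

/-- **The clean space of an embedded configuration is the work space of its base.** [folklore] -/
theorem cleanSpace_cfgM (c : M.tm.Cfg) (a b : List Bool) :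
    (idle M).cleanSpace (cfgM c a b) = M.workSpace c := by
  letI := M.tm.kFin
  unfold CatalyticMachine.cleanSpace SpaceMachine.workSpace
  change ∑ k ∈ ((((Finset.univ : Finset (M.tm.K ⊕ Aux)).erase (Sum.inl M.tm.k₀)).erase
      (Sum.inl M.kL)).erase (Sum.inr Aux.CA)).erase (Sum.inr Aux.CB),
        ((cfgM c a b).stk k).length = _
  rw [cleanStacks_eq, Finset.sum_image (fun a _ b _ h => Sum.inl_injective h)]
  rfl

/-- The catalytic stacks of an embedded configuration hold `a`, `b`. [folklore] -/
theorem catSpace_cfgM (c : M.tm.Cfg) (a b : List Bool) :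
    (idle M).catSpace (cfgM c a b) = a.length + b.length := rfl

end Idle

/-- **A space-`S` decider with two idle stacks is a catalytic decider** with clean space `S`, any
catalytic length `C` and no overshoot: along the run the input is kept and the work space bound of
`M` is the clean space bound (every reachable configuration is embedded over a reachable
configuration of `M`, `reaches_cfgM`), the catalytic stacks never change, and the run halts in the
embedded halting configuration of `M` — answer `[x ∈ L]`, `CA = τ`, `CB = []`.
[cite: BuhrmanEtAl2014, §1, p. 2 (catalytic logspace versus DSPACE(log n)); KouckyEtAl2025 §1 (L ⊆ CL)] -/
theorem catalyticDecides {M : SpaceMachine Bool Bool} {L : Language Bool} {S : List Bool → ℕ}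
    (h : DecidesInSpace M L S) (C : List Bool → ℕ) : CatalyticDecides (idle M) L S C 0 := by
  intro x τ hτ
  rw [catInit_idle]
  refine ⟨fun e he => ?_, ?_⟩
  · obtain ⟨d, hd, rfl⟩ := reaches_cfgM M.tm (c := M.init x) he
    exact ⟨(inputOf_cfgM M d _ _).trans (h.1 x d hd),
      (cleanSpace_cfgM M d _ _).trans_le ((h.2 x).2 d hd),
      (catSpace_cfgM M d _ _).trans_le (by rw [List.length_map, hτ]; simp)⟩
  · obtain ⟨c, hc, hout⟩ := (h.2 x).1
    have ha := (answer_iff_eq_encodeBool L x ((c.stk M.tm.k₁).map M.outputAlphabet)).2 hout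
    exact ⟨cfgM c _ [], cfgM_mem_eval M.tm hc _ _, ha.1, ha.2, rfl, rfl⟩

end CatalyticIdle

/-! ### Class-level consequences -/

/-- **`SpaceClass s ⊆ CSPACE s c`** for every catalytic length `c`: deterministic space `s` is
catalytic space `s` with an untouched catalytic tape. [cite: BuhrmanEtAl2014, §1, p. 2 and Def. 14; KouckyEtAl2025 §1 (L ⊆ CL)] -/
theorem spaceClass_subset_CSPACE (s c : ℕ → ℕ) : SpaceClass s ⊆ CSPACE s c :=
  fun _ ⟨M, hM⟩ => ⟨CatalyticIdle.idle M, 0, CatalyticIdle.catalyticDecides hM _⟩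

/-- `DSPACE s` inside catalytic space: `L ∈ DSPACE s` lies in `CSPACE (d·s + d) c` for its
constant `d` and every `c`. [cite: BuhrmanEtAl2014, Def. 14 (CSPACE(S, S_a) ⊇ DSPACE(S), the work tape alone)] -/
theorem DSPACE_subset_CSPACE {s : ℕ → ℕ} {L : Language Bool} (hL : L ∈ DSPACE s) (c : ℕ → ℕ) :
    ∃ d : ℕ, L ∈ CSPACE (fun n => d * s n + d) c := by
  obtain ⟨d, hd⟩ := hL
  exact ⟨d, spaceClass_subset_CSPACE _ c hd⟩

/-- **`LOGSPACE ⊆ CL`** (the trivial half of `L ⊆ CL ⊆ ZPP`). [cite: BuhrmanEtAl2014, §1, p. 2; KouckyEtAl2025 §1] -/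
theorem LOGSPACE_subset_CL : LOGSPACE ⊆ CL := by
  rintro L ⟨d, hd⟩
  exact (mem_CL_iff_exists_CSPACE L).2 ⟨d, 0, spaceClass_subset_CSPACE _ _ hd⟩

end Literature.Computability.Complexity

end
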